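import Summits.QuantumFields.BalabanUV.Beta.FP.LatticeKernelShiftChain
import Summits.QuantumFields.BalabanUV.Beta.FP.PerfectPropagatorRemainderSymbolNPeriodic
import Summits.QuantumFields.BalabanUV.Beta.FP.PerfectPropagatorKernel

/-!
# `BalabanUV.Beta.FP.PerfectPropagatorKernelGradedChain` — road «FP» for binder row D1, leaf H2-P of the horizontal route, row H2-P-KER-ASM v1.1 (R-FP-21 (B3),
# owner NEXT l.22424, holder gan24-formalise-leaf-05-g35 INTENT l.22570), PART V2a: THE GRADED PRODUCT CHAINS — the every-order remainder members `remSlN` at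
# `Re W_∞` read as functions of a complex momentum, their five integration-by-parts rows on every punctured slice, and the rows + GRADED LETTERS of their
# Leibniz products with one resp. two character chains `e^{ip_μ} − 1` (ONE resp. TWO powers gained at the origin).

HONEST DEPENDENCY (page 1, mandatory): continuum YM on T⁴ ⇐ BetaPertH ∧ nine spine estimates (0/9 proved); BetaPertH ⇐ (D1) ∧ (D4) ∧ CAP+tail;
G-an2-4 gates asym, D1 and NE2/3/4.  HONEST FRAMING (cell contract, verbatim): «discharging `BetaPertH` makes Bałaban's UV stability UNCONDITIONAL —
a real constructive-QFT result; it is NOT the continuum limit and NOT the Clay problem.»  THIS MODULE DISCHARGES NOTHING of the wall: [our object] assembly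
BY NAME of THIS lineage's every-order chain `FP/PerfectPropagatorRemainderSymbolN(Periodic)` (`norm_remSlN_wInf_le`, `hasDerivAt_remSlN_wInf_U`,
`continuousOn_remSlN_wInf_Icc`, `remSlN_wInf_neg_pi_eq_pi`) with PART V1 `FP/LatticeKernelShiftChain` (character chain, product family, graded Leibniz letters).
Constants existential-grade (through `KremP`: `bound166`, `delta166`).  0 `def … : Prop`; nothing cited; 0 sorry; 0 estimates of Bałaban's CONSTRAINED kernels;
0 wall binders; NOT D1, NEVER «G-an2-4 closed», NOT BetaPertH, NOT continuum, NOT Clay.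

ABSOLUTE RULE (cell charter, verbatim): «No internally-minted statement may enter as a cited fact. Every hypothesis is either kernel-proved in this package or a
verbatim quotation of a PUBLISHED theorem with page reference. The manuscript(s) under audit are NOT citable for their own disputed steps — they are the thing
under adjudication; programme-internal (2001/route/tribunal) claims are never citable.»

WHAT (lattice dimension `d + 1`; shift directions `μ, ν`, slice coordinate `i`, slices `s ↦ i.insertNth (s : ℂ) (ofRealVec q)` with `q ∈ BZ d ∖ {0}`; letters at
`N = 5`, regularity rows at `N = 6`):
* §1 [our object] `KremP_nonneg`, `KremPmax d := Σ_{n ≤ 5} KremP 5 n d` (one letter constant for all orders `≤ 5`), `KremP_le_KremPmax`, `KremPmax_nonneg`, `one_le_pi`.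
* §2 [our object] THE MEMBER FAMILY `memN i α β a P := remSlN wInf (reVec P) i α β a (Re P_i)`; `remSlN_update` (base-point invariance); `memN_slice`; rows
  `memN_hder` (`a < 6`, open interval), `memN_hcont`, `memN_hper`, and the graded letter `memN_letter` (`‖memN a‖ ≤ KremPmax d·‖p‖^{(0 − a : ℤ)}`, `a ≤ 5`).
* §3 [our object] rows of the product families `prodN (memN i α β) μ i k` (`E1_*`) and `prodN (prodN (memN i α β) μ i) ν i k` (`E2_*`): links (`k < 6`),
  continuity, endpoints, letters `E1_letter` (`≤ 2^k·(KremPmax d·π^k)·‖p‖^{(1 − k)}`), `E1_letter'` (one constant, grading `1`), `E2_letter`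
  (`≤ 2^k·((2⁵π⁵·KremPmax d)·π^k)·‖p‖^{(2 − k)}`).
Consumer: PART V2b `FP/PerfectPropagatorKernelGraded` ((K2)∕(K3)).

Provenance: binder row D1 formalisation swarm, lineage beta-d1-formalise-leaf-01, gen 9 (prover-b2b-balaban-beta-d1-formalise-leaf-01-g9-0), 2026-08-20;
road FP (owner b2b-balaban-beta-d1-p3), row H2-P-KER-ASM (holder gan24-formalise-leaf-05-g35); OFFER l.22410, REPLY l.22585.
-/

noncomputable section

namespace Summit.QuantumFields.BalabanUV.Beta.FP.PerfectPropagatorKernelGradedChain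

open MeasureTheory Set Complex Filter Topology Finset
open scoped Real BigOperators
open Literature.MathematicalPhysics.QuantumFieldTheory.Balaban1983to89
open B4Strip (ofRealVec)
open B4ContourShift (BZ ofRealVec_insertNth)
open Summit.QuantumFields.BalabanUV.Beta.FP.PerfectPropagatorKernel (reVec reVec_insertNth)
open Summit.QuantumFields.BalabanUV.Beta.FP.PerfectPropagatorRemainderSymbol (wInf)
open Summit.QuantumFields.BalabanUV.Beta.FP.RemainderSymbolSlice (excSl_update)
open Summit.QuantumFields.BalabanUV.Beta.FP.RemainderSymbolSliceN (remSlN invSl zSlN feynC_update)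
open Summit.QuantumFields.BalabanUV.Beta.FP.RemainderSymbolSliceNBound (Krem KF KZ one_le_KZ)
open Summit.QuantumFields.BalabanUV.Beta.FP.PerfectSymbolDerivN (KRPN KAPN cwPN_nonneg)
open Summit.QuantumFields.BalabanUV.Beta.FP.PerfectPropagatorRemainderSymbolN (c0P KremP norm_remSlN_wInf_le)
open Summit.QuantumFields.BalabanUV.Beta.FP.PerfectPropagatorRemainderSymbolNPeriodic (remSlN_wInf_neg_pi_eq_pi hasDerivAt_remSlN_wInf_U
  continuousOn_remSlN_wInf_Icc)
open Summit.QuantumFields.BalabanUV.Beta.FP.PerfectRemainderSliceLocal (Icc_subset_U)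
open Summit.QuantumFields.BalabanUV.Beta.FP.LatticeKernelShiftChain (prodN hasDerivAt_prodN continuousOn_prodN prodN_neg_pi_eq_pi norm_prodN_le)
open Summit.QuantumFields.BalabanUV.Beta.FP.MaxwellSymbolDeriv (update_insertNth)
open Summit.QuantumFields.BalabanUV.Beta.FP.DispersionSliceChain (insertNth_mem_BZ norm_insertNth_le_pi norm_insertNth_pos)

variable {d : ℕ}

/-! ## §1 One letter constant for all orders `≤ 5` -/

/-- [folklore] the every-order letter constants are non-negative. -/
theorem KremP_nonneg (N n d : ℕ) : 0 ≤ KremP N n d := by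
  unfold KremP Krem
  have h1 : 0 ≤ c0P d := by unfold c0P; positivity
  have h2 : 0 ≤ KRPN N d := by unfold KRPN; have := cwPN_nonneg N d; positivity
  have h3 : 0 ≤ max (KF N (c0P d) (KAPN N d) d) (KZ N) := le_trans zero_le_one ((one_le_KZ N).trans (le_max_right _ _))
  refine mul_nonneg (mul_nonneg (by positivity) ?_) (pow_nonneg h3 n)
  exact mul_nonneg (mul_nonneg h1 (mul_nonneg h2 (by positivity))) (by positivity)

/-- [our object] ONE LETTER CONSTANT FOR THE ORDERS `0 … 5`: `KremPmax d := Σ_{n ≤ 5} KremP 5 n d`. -/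
def KremPmax (d : ℕ) : ℝ := ∑ n ∈ Finset.range 6, KremP 5 n d

/-- [folklore] `KremP 5 n d ≤ KremPmax d` for `n ≤ 5`. -/
theorem KremP_le_KremPmax {n : ℕ} (hn : n ≤ 5) (d : ℕ) : KremP 5 n d ≤ KremPmax d := by
  unfold KremPmax
  exact Finset.single_le_sum (f := fun m => KremP 5 m d) (fun m _ => KremP_nonneg 5 m d) (Finset.mem_range.mpr (by omega))

/-- [folklore] `0 ≤ KremPmax d`. -/
theorem KremPmax_nonneg (d : ℕ) : 0 ≤ KremPmax d := Finset.sum_nonneg fun m _ => KremP_nonneg 5 m d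

/-- [folklore] `1 ≤ π`. -/
theorem one_le_pi : (1 : ℝ) ≤ π := by linarith [Real.pi_gt_three]

/-! ## §2 The member family and its rows on punctured slices -/

/-- [our object] THE MEMBER FAMILY read through real parts: `memN i α β a P := remSlN wInf (reVec P) i α β a (Re P_i)` (order `a` slice derivative of the
remainder symbol `B` in the coordinate `i` at the real momentum `reVec P`). -/
def memN (i α β : Fin (d + 1)) (a : ℕ) (P : Fin (d + 1) → ℂ) : ℂ := remSlN (wInf (d := d)) (reVec P) i α β a ((P i).re)

/-- [folklore] base-point invariance of the every-order members: they depend on `s` only through the line `{update s i u}`. -/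
theorem remSlN_update (w : Fin (d + 1) → Fin (d + 1) → (Fin (d + 1) → ℝ) → ℝ) (s : Fin (d + 1) → ℝ) (i : Fin (d + 1)) (t₀ : ℝ) :
    remSlN w (Function.update s i t₀) i = remSlN w s i := by
  funext α β n u
  unfold remSlN
  have h1 : invSl w (Function.update s i t₀) i = invSl w s i := by funext j v; simp only [invSl, feynC_update]
  have h2 : zSlN (Function.update s i t₀) i = zSlN s i := by funext j v; simp only [zSlN, Fin.removeNth_update]
  rw [h1, excSl_update, h2]

section Rows

variable (μ ν i α β : Fin (d + 1)) {q : Fin d → ℝ}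

/-- [our object] THE MEMBERS ON A SLICE at the base point `insertNth i 0 q`: `memN i α β a (insertNth i t q) = remSlN wInf (insertNth i 0 q) i α β a t`. -/
theorem memN_slice (a : ℕ) (q : Fin d → ℝ) (t : ℝ) :
    memN i α β a (i.insertNth (t : ℂ) (ofRealVec q)) = remSlN (wInf (d := d)) (i.insertNth (0 : ℝ) q) i α β a t := by
  unfold memN
  rw [reVec_insertNth]
  have e2 : ((i.insertNth (t : ℂ) (ofRealVec q) : Fin (d + 1) → ℂ) i).re = t := by simp
  rw [e2, ← update_insertNth i 0 t q, remSlN_update]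

/-- [folklore] the base point lies in the zone. -/
theorem base_mem_BZ (hq : q ∈ BZ d) : (i.insertNth (0 : ℝ) q : Fin (d + 1) → ℝ) ∈ BZ (d + 1) :=
  insertNth_mem_BZ i ⟨by linarith [Real.pi_pos], by linarith [Real.pi_pos]⟩ hq

/-- [folklore] the transverse part of the base point is `q`. -/
theorem removeNth_base (q : Fin d → ℝ) : i.removeNth (i.insertNth (0 : ℝ) q : Fin (d + 1) → ℝ) = q := by simp

variable {μ ν i α β}

/-- [our object] the `hder` rows of the members: for `q ∈ BZ d ∖ {0}`, `a < 6`, `t ∈ (−π, π)`, the slice link `memN a → memN (a+1)`. -/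
theorem memN_hder (hq : q ∈ BZ d) (hq0 : q ≠ 0) {a : ℕ} (ha : a < 6) {t : ℝ} (ht : t ∈ Ioo (-π) π) :
    HasDerivAt (fun s : ℝ => memN i α β a (i.insertNth (s : ℂ) (ofRealVec q))) (memN i α β (a + 1) (i.insertNth (t : ℂ) (ofRealVec q))) t := by
  have hq0' : i.removeNth (i.insertNth (0 : ℝ) q : Fin (d + 1) → ℝ) ≠ 0 := by rw [removeNth_base]; exact hq0
  have e : (fun s : ℝ => memN i α β a (i.insertNth (s : ℂ) (ofRealVec q))) = remSlN (wInf (d := d)) (i.insertNth (0 : ℝ) q) i α β a := by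
    funext s; exact memN_slice i α β a q s
  rw [e, memN_slice]
  exact hasDerivAt_remSlN_wInf_U (base_mem_BZ i hq) hq0' 6 (Icc_subset_U (Ioo_subset_Icc_self ht)) ha α β

/-- [our object] the `hcont` rows of the members (`a < 6`). -/
theorem memN_hcont (hq : q ∈ BZ d) (hq0 : q ≠ 0) {a : ℕ} (ha : a < 6) :
    ContinuousOn (fun s : ℝ => memN i α β a (i.insertNth (s : ℂ) (ofRealVec q))) (uIcc (-π) π) := by
  have hq0' : i.removeNth (i.insertNth (0 : ℝ) q : Fin (d + 1) → ℝ) ≠ 0 := by rw [removeNth_base]; exact hq0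
  have e : (fun s : ℝ => memN i α β a (i.insertNth (s : ℂ) (ofRealVec q))) = remSlN (wInf (d := d)) (i.insertNth (0 : ℝ) q) i α β a := by
    funext s; exact memN_slice i α β a q s
  rw [e, Set.uIcc_of_le (by linarith [Real.pi_pos])]
  exact continuousOn_remSlN_wInf_Icc (base_mem_BZ i hq) hq0' 6 ha α β

/-- [our object] the `hper` rows of the members (every order). -/
theorem memN_hper (hq : q ∈ BZ d) (a : ℕ) :
    memN i α β a (i.insertNth (((-π : ℝ)) : ℂ) (ofRealVec q)) = memN i α β a (i.insertNth ((π : ℝ) : ℂ) (ofRealVec q)) := by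
  have hq' : i.removeNth (i.insertNth (0 : ℝ) q : Fin (d + 1) → ℝ) ∈ BZ d := by rw [removeNth_base]; exact hq
  rw [memN_slice, memN_slice]
  exact remSlN_wInf_neg_pi_eq_pi hq' a α β

/-- [our object] **THE GRADED MEMBER LETTERS**: for `q ∈ BZ d ∖ {0}`, `t ∈ [−π, π]`, `a ≤ 5`:
`‖memN i α β a (insertNth i t q)‖ ≤ KremPmax d·‖insertNth i t q‖^{(0 − a : ℤ)}` (`norm_remSlN_wInf_le` at `N = 5`). -/
theorem memN_letter (hq : q ∈ BZ d) (hq0 : q ≠ 0) {a : ℕ} (ha : a ≤ 5) {t : ℝ} (ht : t ∈ Icc (-π) π) :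
    ‖memN i α β a (i.insertNth (t : ℂ) (ofRealVec q))‖ ≤ KremPmax d * ‖(i.insertNth t q : Fin (d + 1) → ℝ)‖ ^ ((0 : ℤ) - a) := by
  have hq0' : i.removeNth (i.insertNth (0 : ℝ) q : Fin (d + 1) → ℝ) ≠ 0 := by rw [removeNth_base]; exact hq0
  rw [memN_slice]
  have h := norm_remSlN_wInf_le 5 (base_mem_BZ i hq) ht hq0' ha α β
  rw [update_insertNth] at h
  have hρ : 0 < ‖(i.insertNth t q : Fin (d + 1) → ℝ)‖ := norm_insertNth_pos i t hq0
  calc ‖remSlN (wInf (d := d)) (i.insertNth (0 : ℝ) q) i α β a t‖ ≤ KremP 5 a d / ‖(i.insertNth t q : Fin (d + 1) → ℝ)‖ ^ a := h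
    _ ≤ KremPmax d / ‖(i.insertNth t q : Fin (d + 1) → ℝ)‖ ^ a := div_le_div_of_nonneg_right (KremP_le_KremPmax ha d) (pow_nonneg hρ.le _)
    _ = KremPmax d * ‖(i.insertNth t q : Fin (d + 1) → ℝ)‖ ^ ((0 : ℤ) - a) := by rw [zero_sub, zpow_neg, zpow_natCast, div_eq_mul_inv]

/-! ## §3 The product families (one and two characters) and their rows -/

/-- [our object] links of the one-character family `prodN (memN i α β) μ i k → (k+1)` for `k < 6` on the open interval. -/
theorem E1_hder (hq : q ∈ BZ d) (hq0 : q ≠ 0) {k : ℕ} (hk : k < 6) {t : ℝ} (ht : t ∈ Ioo (-π) π) :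
    HasDerivAt (fun s : ℝ => prodN (memN i α β) μ i k (i.insertNth (s : ℂ) (ofRealVec q)))
      (prodN (memN i α β) μ i (k + 1) (i.insertNth (t : ℂ) (ofRealVec q))) t :=
  hasDerivAt_prodN fun _ ha => memN_hder hq hq0 (lt_of_le_of_lt ha hk) ht

/-- [our object] continuity of the one-character family (`k < 6`). -/
theorem E1_hcont (hq : q ∈ BZ d) (hq0 : q ≠ 0) {k : ℕ} (hk : k < 6) :
    ContinuousOn (fun s : ℝ => prodN (memN i α β) μ i k (i.insertNth (s : ℂ) (ofRealVec q))) (uIcc (-π) π) :=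
  continuousOn_prodN fun _ ha => memN_hcont hq hq0 (lt_of_le_of_lt ha hk)

/-- [our object] equal endpoint values of the one-character family. -/
theorem E1_hper (hq : q ∈ BZ d) (k : ℕ) :
    prodN (memN i α β) μ i k (i.insertNth (((-π : ℝ)) : ℂ) (ofRealVec q)) = prodN (memN i α β) μ i k (i.insertNth ((π : ℝ) : ℂ) (ofRealVec q)) :=
  prodN_neg_pi_eq_pi fun a _ => memN_hper hq a

/-- [our object] **THE ONE-CHARACTER LETTER**: `‖prodN (memN i α β) μ i k (insertNth i t q)‖ ≤ 2^k·(KremPmax d·π^k)·‖insertNth i t q‖^{(1 − k : ℤ)}`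
(`k ≤ 5`) — one power gained. -/
theorem E1_letter (hq : q ∈ BZ d) (hq0 : q ≠ 0) {k : ℕ} (hk : k ≤ 5) {t : ℝ} (ht : t ∈ Icc (-π) π) :
    ‖prodN (memN i α β) μ i k (i.insertNth (t : ℂ) (ofRealVec q))‖
      ≤ 2 ^ k * (KremPmax d * π ^ k) * ‖(i.insertNth t q : Fin (d + 1) → ℝ)‖ ^ ((0 : ℤ) + 1 - k) := by
  rw [← ofRealVec_insertNth]
  refine norm_prodN_le (norm_insertNth_pos i t hq0) (norm_insertNth_le_pi i ht hq) one_le_pi fun a ha => ?_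
  rw [ofRealVec_insertNth]
  exact memN_letter hq hq0 (ha.trans hk) ht

/-- [our object] the one-character letters with ONE constant for all orders `a ≤ 5` (grading `1`): `≤ (2⁵·π⁵·KremPmax d)·‖p‖^{(1 − a)}`. -/
theorem E1_letter' (hq : q ∈ BZ d) (hq0 : q ≠ 0) {a : ℕ} (ha : a ≤ 5) {t : ℝ} (ht : t ∈ Icc (-π) π) :
    ‖prodN (memN i α β) μ i a (ofRealVec (i.insertNth t q))‖
      ≤ (2 ^ 5 * π ^ 5 * KremPmax d) * ‖(i.insertNth t q : Fin (d + 1) → ℝ)‖ ^ ((1 : ℤ) - a) := by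
  rw [ofRealVec_insertNth]
  have h := E1_letter (μ := μ) (i := i) (α := α) (β := β) hq hq0 ha ht
  have hρ : 0 < ‖(i.insertNth t q : Fin (d + 1) → ℝ)‖ := norm_insertNth_pos i t hq0
  have hmono : (2 : ℝ) ^ a * π ^ a ≤ 2 ^ 5 * π ^ 5 := by
    rw [← mul_pow, ← mul_pow]
    exact pow_le_pow_right₀ (by linarith [Real.pi_gt_three]) ha
  have e : (0 : ℤ) + 1 - a = (1 : ℤ) - a := by ring
  rw [e] at h
  refine h.trans ?_
  have hz : 0 ≤ ‖(i.insertNth t q : Fin (d + 1) → ℝ)‖ ^ ((1 : ℤ) - a) := zpow_nonneg hρ.le _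
  have hK := KremPmax_nonneg d
  calc 2 ^ a * (KremPmax d * π ^ a) * ‖(i.insertNth t q : Fin (d + 1) → ℝ)‖ ^ ((1 : ℤ) - a)
      = (2 ^ a * π ^ a) * KremPmax d * ‖(i.insertNth t q : Fin (d + 1) → ℝ)‖ ^ ((1 : ℤ) - a) := by ring
    _ ≤ (2 ^ 5 * π ^ 5) * KremPmax d * ‖(i.insertNth t q : Fin (d + 1) → ℝ)‖ ^ ((1 : ℤ) - a) :=
        mul_le_mul_of_nonneg_right (mul_le_mul_of_nonneg_right hmono hK) hz
    _ = (2 ^ 5 * π ^ 5 * KremPmax d) * ‖(i.insertNth t q : Fin (d + 1) → ℝ)‖ ^ ((1 : ℤ) - a) := by ring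

/-- [our object] links of the two-character family `prodN (prodN (memN i α β) μ i) ν i k → (k+1)` for `k < 6`. -/
theorem E2_hder (hq : q ∈ BZ d) (hq0 : q ≠ 0) {k : ℕ} (hk : k < 6) {t : ℝ} (ht : t ∈ Ioo (-π) π) :
    HasDerivAt (fun s : ℝ => prodN (prodN (memN i α β) μ i) ν i k (i.insertNth (s : ℂ) (ofRealVec q)))
      (prodN (prodN (memN i α β) μ i) ν i (k + 1) (i.insertNth (t : ℂ) (ofRealVec q))) t :=
  hasDerivAt_prodN fun _ ha => E1_hder hq hq0 (lt_of_le_of_lt ha hk) ht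

/-- [our object] continuity of the two-character family (`k < 6`). -/
theorem E2_hcont (hq : q ∈ BZ d) (hq0 : q ≠ 0) {k : ℕ} (hk : k < 6) :
    ContinuousOn (fun s : ℝ => prodN (prodN (memN i α β) μ i) ν i k (i.insertNth (s : ℂ) (ofRealVec q))) (uIcc (-π) π) :=
  continuousOn_prodN fun _ ha => E1_hcont hq hq0 (lt_of_le_of_lt ha hk)

/-- [our object] equal endpoint values of the two-character family. -/
theorem E2_hper (hq : q ∈ BZ d) (k : ℕ) :
    prodN (prodN (memN i α β) μ i) ν i k (i.insertNth (((-π : ℝ)) : ℂ) (ofRealVec q))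
      = prodN (prodN (memN i α β) μ i) ν i k (i.insertNth ((π : ℝ) : ℂ) (ofRealVec q)) :=
  prodN_neg_pi_eq_pi fun a _ => E1_hper hq a

/-- [our object] **THE TWO-CHARACTER LETTER**: `‖prodN (prodN (memN i α β) μ i) ν i k (insertNth i t q)‖ ≤ 2^k·((2⁵π⁵·KremPmax d)·π^k)·‖insertNth i t q‖^{(2 − k)}`
(`k ≤ 5`) — two powers gained. -/
theorem E2_letter (hq : q ∈ BZ d) (hq0 : q ≠ 0) {k : ℕ} (hk : k ≤ 5) {t : ℝ} (ht : t ∈ Icc (-π) π) :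
    ‖prodN (prodN (memN i α β) μ i) ν i k (i.insertNth (t : ℂ) (ofRealVec q))‖
      ≤ 2 ^ k * ((2 ^ 5 * π ^ 5 * KremPmax d) * π ^ k) * ‖(i.insertNth t q : Fin (d + 1) → ℝ)‖ ^ ((1 : ℤ) + 1 - k) := by
  rw [← ofRealVec_insertNth]
  exact norm_prodN_le (norm_insertNth_pos i t hq0) (norm_insertNth_le_pi i ht hq) one_le_pi fun a ha => E1_letter' hq hq0 (ha.trans hk) ht

end Rows

end Summit.QuantumFields.BalabanUV.Beta.FP.PerfectPropagatorKernelGradedChain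

end
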